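import Summits.QuantumAdvantage.QuantumAdvantage.Theorems.LinnikCubicClassGroupsDegreeOnePrimesEscapeSplittingTypeDivision
import Summits.QuantumAdvantage.QuantumAdvantage.Theorems.LinnikCubicClassGroupsDegreeOnePrimesEscapeDivisionPNTPiCongr
import Summits.QuantumAdvantage.QuantumAdvantage.Theorems.LinnikCubicClassGroupsDegreeOnePrimesEscapeDivisionPNTQuadraticZeroFree
import Summits.QuantumAdvantage.QuantumAdvantage.Theorems.LinnikCubicClassGroupsDegreeOnePrimesEscapePureCubicInertPrime
import HarnessLib

/-!
# The Chebotarev density theorem for pure cubic fields in the Linnik range, with no exceptional term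

Topic `Summits/QuantumAdvantage/QuantumAdvantage/Theorems`, cell B2b-1 (linnik-cubic), PART A (gen 11);
helper toward the crux `DegreeOnePrimesEscape` (stmt-QuantumAdvantage-11543) of route
`LinnikCubicClassGroups` — the route's own family `K = ℚ(∛m)`.  HONEST FRAMING: the value of this file is
a THEOREM (kernel-checked, GRH-free, Siegel-free, no hypothesis) — NOT summit progress.

**Theorem** (`splittingType_PNT_pureCubic`).  For `0 < ε ≤ 1` there is an absolute `L > 0` such that for
every cube-free... more precisely every `m ∈ ℕ` that is not a rational cube, every cubic number field
`K ∋ α` with `α³ = m` (so `K ≅ ℚ(∛m)`), and every `x ≥ |d_K|^L`: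

  `|#{p ≤ x : p splits completely in K} − Li(x)/6| ≤ ε Li(x)/6`,
  `|#{p ≤ x : p = 𝔭₁𝔭₂, f = (1,2)}   − Li(x)/2| ≤ ε Li(x)/2`,
  `|#{p ≤ x : p inert in K}            − Li(x)/3| ≤ ε Li(x)/3`,

the three conditions being `splittingType K p = {1,1,1}`, `{1,2}`, `{3}` (Perlis's splitting type: the
multiset of residue degrees of the primes above `p`; ALL primes `p ≤ x` are counted, the `≤ 2 log|d_N|`
ramified ones being absorbed in the error).  NO exceptional (Siegel) term: the Galois closure
`N = K(ζ₃)` has the single quadratic subfield `ℚ(√−3)`, whose zeta function has no real zero near `1`, so by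
Heilbronn–Stark `ζ_N` has no exceptional zero (`division_PNT_pi_congr`, case (A), with the window shrunk
into the zero-free interval of `ℚ(√−3)`).  This is the Chebotarev density theorem for `S₃ = Gal(N/ℚ)`
with relative error `ε` for all `x ≥ |d_K|^{L(ε)}` [LagariasMontgomeryOdlyzko1979, Thm 1.1;
ThornerZaman2019, Thm 1.4], unconditional, `L` inexplicit.

Also `factorial_three_le_finrank_of_not_isGalois`: a non-Galois cubic field is an `S₃`-field in the sense
of `symmetricClosure`.
-/

noncomputable section

open scoped NumberField nonZeroDivisors
open Finset Real Ideal NumberField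
open Literature.NumberTheory.NumberFields Literature.NumberTheory.LFunctions
  Literature.NumberTheory.LFunctions.NumberField

namespace Summit.QuantumAdvantage.QuantumAdvantage.Theorems.DegreeOnePrimesEscape

/-- **A non-Galois cubic field is an `S₃`-field**: every Galois number field into which it embeds has
degree `≥ 3! = 6`. -/
theorem factorial_three_le_finrank_of_not_isGalois {K : Type*} [Field K] [NumberField K]
    (h3 : Module.finrank ℚ K = 3) (hK : ¬ IsGalois ℚ K) (M : Type*) [Field M] [NumberField M]
    [IsGalois ℚ M] (f : K →ₐ[ℚ] M) : Nat.factorial 3 ≤ Module.finrank ℚ M := by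
  have hK' : Module.finrank ℚ f.fieldRange = 3 := by
    rw [← f.equivFieldRange.toLinearEquiv.finrank_eq, h3]
  have hmul := Module.finrank_mul_finrank ℚ f.fieldRange M
  have hpos : 0 < Module.finrank f.fieldRange M := Module.finrank_pos
  rw [hK'] at hmul
  by_contra hlt
  have h1 : Module.finrank f.fieldRange M = 1 := by
    have : Nat.factorial 3 = 6 := rfl
    omega
  have htop : f.fieldRange = ⊤ := IntermediateField.finrank_eq_one_iff_eq_top.mp h1
  have e : K ≃ₐ[ℚ] M :=
    (f.equivFieldRange.trans (IntermediateField.equivOfEq htop)).trans IntermediateField.topEquiv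
  exact hK (IsGalois.of_algEquiv e.symm)

set_option maxHeartbeats 4000000 in
/-- **The Chebotarev density theorem for the pure cubic fields in the Linnik range, with no exceptional
term** (see the module docstring): densities `1/6, 1/2, 1/3` for the splitting types `{1,1,1}, {1,2}, {3}`,
relative error `ε`, all `x ≥ |d_K|^L`, `L = L(ε)` absolute.  Unconditional.
[cite: LagariasMontgomeryOdlyzko1979, Theorem 1.1] [cite: ThornerZaman2019, Theorem 1.4] -/
theorem splittingType_PNT_pureCubic {ε : ℝ} (hε : 0 < ε) (hε1 : ε ≤ 1) :
    ∃ L : ℝ, 0 < L ∧ ∀ (m : ℕ), (∀ b : ℚ, b ^ 3 ≠ (m : ℚ)) →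
      ∀ (K : Type) [Field K] [NumberField K], Module.finrank ℚ K = 3 → ∀ α : K, α ^ 3 = (m : K) →
        ∀ x : ℝ, ((NumberField.discr K).natAbs : ℝ) ^ L ≤ x →
          |((((Nat.primesLE ⌊x⌋₊).filter (fun p : ℕ => splittingType K p = {1, 1, 1})).card : ℕ) : ℝ) -
              offsetLogIntegral x / 6| ≤ ε * (offsetLogIntegral x / 6) ∧
          |((((Nat.primesLE ⌊x⌋₊).filter (fun p : ℕ => splittingType K p = {1, 2})).card : ℕ) : ℝ) -
              offsetLogIntegral x / 2| ≤ ε * (offsetLogIntegral x / 2) ∧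
          |((((Nat.primesLE ⌊x⌋₊).filter (fun p : ℕ => splittingType K p = {3})).card : ℕ) : ℝ) -
              offsetLogIntegral x / 3| ≤ ε * (offsetLogIntegral x / 3) := by
  obtain ⟨c₀, hc₀, -, hZ⟩ := SexticEscapeCount.exists_zeroFree_quadratic_of_discr_eq_neg_three
  obtain ⟨L₀, c, hL₀, hc, hcc₀, hc4, h⟩ := division_PNT_pi_congr 6 (by norm_num) hε hε1 hc₀
  refine ⟨6 * L₀, by positivity, fun m hm K _ _ h3 α hα x hx => ?_⟩
  -- the `S₃`-closure
  have hKng : ¬ IsGalois ℚ K := fun hG =>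
    Honda1971.pow_three_ne_natCast_of_isGalois (E := K) h3 hm α hα
  obtain ⟨N, _, _, hGal, hdeg, K', e, ψ, hstab, hdN⟩ :=
    symmetricClosure 3 K h3 (fun M _ _ _ f => factorial_three_le_finrank_of_not_isGalois h3 hKng M f)
  haveI := hGal
  have hdeg6 : Module.finrank ℚ N = 6 := by rw [hdeg]; rfl
  have hN1 : 1 < Module.finrank ℚ N := by rw [hdeg6]; norm_num
  -- the quadratic subfield `ℚ(√−3)`
  have hγ : ((e α : K') : N) ^ 3 = (m : N) := by
    have h1 : (e α) ^ 3 = (m : K') := by rw [← map_pow, hα, map_natCast]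
    have h2 := congrArg (fun z : K' => (z : N)) h1
    simpa using h2
  obtain ⟨ω, hω⟩ := exists_isPrimitiveRoot_three_of_cube_eq hm hγ
  obtain ⟨k₀, hk₀, ⟨ek⟩⟩ := exists_quadratic_cyclotomic_subfield hω
  have hdk₀ : NumberField.discr k₀ = -3 := by
    rw [NumberField.discr_eq_discr_of_algEquiv _ ek, discr_cyclotomicField_three]
  -- sizes
  set d : ℝ := ((NumberField.discr K).natAbs : ℝ) with hd
  set dN : ℝ := ((NumberField.discr N).natAbs : ℝ) with hdN'
  have hd3 : (3 : ℝ) ≤ d := three_le_natAbs_discr_real K (by rw [h3]; norm_num)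
  have hdN3 : (3 : ℝ) ≤ dN := three_le_natAbs_discr_real N hN1
  have hxN : dN ^ L₀ ≤ x := by
    have hdNR : dN ≤ d ^ (6 : ℝ) := by
      rw [show (6 : ℝ) = ((6 : ℕ) : ℝ) by norm_num, Real.rpow_natCast, hd, hdN']
      have : Nat.factorial 3 = 6 := rfl
      rw [this] at hdN
      exact_mod_cast hdN
    calc dN ^ L₀ ≤ (d ^ (6 : ℝ)) ^ L₀ := Real.rpow_le_rpow (by linarith) hdNR hL₀.le
      _ = d ^ (6 * L₀) := by rw [← Real.rpow_mul (by linarith)]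
      _ ≤ x := hx
  -- no exceptional zero of `ζ_N` in the window
  have hexc : ¬ ∃ β₁ : ℝ, dedekindZeta₁ N β₁ = 0 ∧
      1 - c / (Real.log dN + Real.log 4) < β₁ ∧ β₁ < 1 := by
    rintro ⟨β₁, hζ₁, hβ₁c, hβ₁1⟩
    obtain ⟨k, hk2, hk0⟩ := exists_quadratic_subfield_zero_of_exceptional hN1 hc4 hζ₁ hβ₁c hβ₁1
    have hkk : k = k₀ := quadratic_subfield_unique (by rw [hdeg6]; decide) k k₀ hk2 hk₀
    subst hkk
    have hℓ : 1 ≤ Real.log dN + Real.log 4 := by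
      have h4 : 1 < Real.log 4 := by
        rw [show (4 : ℝ) = 2 ^ 2 by norm_num, Real.log_pow]; have := Real.log_two_gt_d9; push_cast; linarith
      have := Real.log_nonneg (by linarith : (1 : ℝ) ≤ dN)
      linarith
    have hwin : c / (Real.log dN + Real.log 4) ≤ c₀ := by
      rw [div_le_iff₀ (by linarith)]; nlinarith
    exact hZ k hk2 hdk₀ β₁ (by linarith) hβ₁1 hk0
  -- the dictionary for a partition `T` of `3`
  have hcardFin : Fintype.card (Fin 3) = 3 := Fintype.card_fin 3
  have hT : ∀ T : Multiset ℕ, T.sum = 3 → (∀ f ∈ T, 0 < f) →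
      |((((Nat.primesLE ⌊x⌋₊).filter (fun p : ℕ => splittingType K p = T)).card : ℕ) : ℝ) -
          ((Finset.univ.filter fun q : Equiv.Perm (Fin 3) =>
              q.cycleType + Multiset.replicate (3 - q.support.card) 1 = T).card : ℝ) / 6 *
            offsetLogIntegral x| ≤
        ε * (((Finset.univ.filter fun q : Equiv.Perm (Fin 3) =>
              q.cycleType + Multiset.replicate (3 - q.support.card) 1 = T).card : ℝ) / 6 *
            offsetLogIntegral x) := by
    intro T hTsum hTpos
    obtain ⟨τ, hτ⟩ := exists_fullCycleType_eq (α := Fin 3) T (by rw [hcardFin]; exact hTsum) hTpos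
    rw [hcardFin] at hτ
    set σ : N ≃ₐ[ℚ] N := ψ.symm τ with hσ
    have hψσ : ψ σ = τ := by rw [hσ, MulEquiv.apply_symm_apply]
    have hP : ∀ p : ℕ, p.Prime → ¬ ((p : ℤ) ∣ NumberField.discr N) →
        (splittingType K p = T ↔ ∃ (Q : Ideal (𝓞 N)) (_ : Q.IsMaximal) (_ : Q.LiesOver (span {(p : ℤ)}))
          (φ g : N ≃ₐ[ℚ] N), IsArithFrobAt ℤ φ Q ∧ Q.inertia (N ≃ₐ[ℚ] N) = ⊥ ∧
            Subgroup.zpowers (g * φ * g⁻¹) = Subgroup.zpowers σ) := by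
      intro p hp hpN
      rw [frobenius_division_iff_splittingType_eq K' ψ hstab σ hp hpN, hψσ, hτ,
        ArithmeticallyEquivalent.of_algEquiv e p hp]
    have hδ : (Nat.card {τ' : N ≃ₐ[ℚ] N // ∃ g : N ≃ₐ[ℚ] N,
          Subgroup.zpowers (g * τ' * g⁻¹) = Subgroup.zpowers σ} : ℝ) / Nat.card (N ≃ₐ[ℚ] N) =
        ((Finset.univ.filter fun q : Equiv.Perm (Fin 3) =>
            q.cycleType + Multiset.replicate (3 - q.support.card) 1 = T).card : ℝ) / 6 := by
      rw [natCard_division_eq_card_filter_fullCycleType ψ, hψσ, hτ, IsGalois.card_aut_eq_finrank, hdeg6]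
      norm_num
    have hmain := (h N hdeg6 σ (fun p : ℕ => splittingType K p = T) hP).1 hexc x hxN
    rw [hδ] at hmain
    exact hmain
  -- the three densities `1/6, 3/6, 2/6`
  have c111 : (Finset.univ.filter fun q : Equiv.Perm (Fin 3) =>
      q.cycleType + Multiset.replicate (3 - q.support.card) 1 = {1, 1, 1}).card = 1 := by decide
  have c12 : (Finset.univ.filter fun q : Equiv.Perm (Fin 3) =>
      q.cycleType + Multiset.replicate (3 - q.support.card) 1 = {1, 2}).card = 3 := by decide
  have c3 : (Finset.univ.filter fun q : Equiv.Perm (Fin 3) =>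
      q.cycleType + Multiset.replicate (3 - q.support.card) 1 = {3}).card = 2 := by decide
  refine ⟨?_, ?_, ?_⟩
  · have := hT {1, 1, 1} (by decide) (by decide)
    rw [c111] at this
    have e1 : (((1 : ℕ) : ℝ)) / 6 * offsetLogIntegral x = offsetLogIntegral x / 6 := by push_cast; ring
    rwa [e1] at this
  · have := hT {1, 2} (by decide) (by decide)
    rw [c12] at this
    have e1 : (((3 : ℕ) : ℝ)) / 6 * offsetLogIntegral x = offsetLogIntegral x / 2 := by push_cast; ring
    rwa [e1] at this
  · have := hT {3} (by decide) (by decide)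
    rw [c3] at this
    have e1 : (((2 : ℕ) : ℝ)) / 6 * offsetLogIntegral x = offsetLogIntegral x / 3 := by push_cast; ring
    rwa [e1] at this

end Summit.QuantumAdvantage.QuantumAdvantage.Theorems.DegreeOnePrimesEscape

end
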